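import Summits.BirchSwinnertonDyer.BirchSwinnertonDyer.Theorems.Rank2Observatory2DescClFamCertQ2
import HarnessLib

/-!
# BirchSwinnertonDyer — rank ≥ 2 observatory: KERNEL-2DESC-CL Q2 — soundness of the family-entry check `famCheck₂` and the four valuation logs, part 2b

HONEST FRAMING: per-curve certified theorems and census instruments; no claim on BSD in rank ≥ 2.

Part 2b of the two-auxiliary-prime variant (part 2a, `Rank2Observatory2DescClFamCertQ2`, holds the computable
family-entry check `famCheck₂`, `invAny`, the primes `W₁₁ W₁₂ W₂₁ W₂₂` as terms and the row lookup; the split is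
only the request size limit).  Soundness lemmas of a checked entry `famCheck₂ fc D f = true`, exactly as part 4
of v2.0: `g ≠ 0`, the norm and sign clauses, residue-character non-divisibility, support `⊆ supp(D·q₁q₂)`
(`supp_of_famCheck₂`), and the four integers `ord_W(g)` read off the packed exponent pair `e = e₁ + 64·e₂` and
the inverse certificates (`log_W₁₁/W₂₁/W₁₂/W₂₂_of_famCheck₂`).

Sorry-free; new declarations only; axioms `propext`, `Classical.choice`, `Quot.sound`.
[cite: Cohen1993, §4.8.2, §6.5] [cite: Marcus2018, Ch. 3, Thm. 22; Ch. 5, Thm. 38] [cite: Cassels1991LecturesEllipticCurves, §15]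
-/

set_option linter.dupNamespace false

noncomputable section

open scoped Classical NumberField nonZeroDivisors

open Literature.NumberTheory.NumberFields Polynomial Module NumberField IsDedekindDomain Ideal

namespace Summit.BirchSwinnertonDyer.BirchSwinnertonDyer.Rank2Observatory.TwoDescCl

open TwoDescCubic

variable {K : Type*} [Field K] [NumberField K] {θ : K} (fc : ClFieldCertQ2)

open ClFieldCertQ2

variable {fc} {D : ℤ × ℤ × ℤ} {f : FamEntry}

/-- The common clauses of a checked entry. -/
theorem common_of_famCheck₂ (h : famCheck₂ fc D f = true) :
    signCond fc.lo fc.hi f.2.2.g f.2.2.sg = true ∧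
      normFormZ fc.a fc.b fc.c f.2.2.g.1 f.2.2.g.2.1 f.2.2.g.2.2 ≠ 0 ∧
      (∀ ch ∈ fc.chars, ¬ (ch.1 : ℤ) ∣ evalInt ch.2.1 f.2.2.g) ∧ famKindCheck₂ fc D f = true := by
  simp only [famCheck₂, Bool.and_eq_true, decide_eq_true_eq, List.all_eq_true, Bool.not_eq_true',
    decide_eq_false_iff_not] at h
  exact ⟨h.1.1.1, h.1.1.2, h.1.2, h.2⟩

/-- The entry is non-zero. [folklore] -/
theorem lin_ne_zero_of_famCheck₂ (hθ : aeval θ (MonicCubic.poly fc.a fc.b fc.c) = 0) (h3 : finrank ℚ K = 3)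
    (hF : fc.check = true) (h : famCheck₂ fc D f = true) :
    (lin hθ f.2.2.g.1 f.2.2.g.2.1 f.2.2.g.2.2 : 𝓞 K) ≠ 0 :=
  lin_ne_zero_of_coords (fc.irreducible_of_check hF) hθ h3 _ (common_of_famCheck₂ h).2.1

/-- The norm of the entry. [cite: Marcus2018, Ch. 2, Thm. 4] -/
theorem norm_of_famCheck₂ {fc : ClFieldCertQ2} (hθ : aeval θ (MonicCubic.poly fc.a fc.b fc.c) = 0) (h3 : finrank ℚ K = 3)
    (hF : fc.check = true) :
    Algebra.norm ℚ ((lin hθ f.2.2.g.1 f.2.2.g.2.1 f.2.2.g.2.2 : 𝓞 K) : K) =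
      ((normFormZ fc.a fc.b fc.c f.2.2.g.1 f.2.2.g.2.1 f.2.2.g.2.2 : ℤ) : ℚ) :=
  norm_lin_coords (fc.irreducible_of_check hF) hθ h3 _

/-- The sign bit. [cite: Cassels1991LecturesEllipticCurves, §15] -/
theorem sign_iff_of_famCheck₂ (hθ : aeval θ (MonicCubic.poly fc.a fc.b fc.c) = 0) (ρ : K →+* ℝ)
    (hlo : ((fc.lo : ℚ) : ℝ) < ρ θ) (hhi : ρ θ < ((fc.hi : ℚ) : ℝ)) (hF : fc.check = true)
    (h : famCheck₂ fc D f = true) :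
    (f.2.2.sg = true ↔ ρ ((lin hθ f.2.2.g.1 f.2.2.g.2.1 f.2.2.g.2.2 : 𝓞 K) : K) < 0) :=
  sign_iff_of_signCond hθ ρ (fc.interval_of_check hF).1 hlo hhi (common_of_famCheck₂ h).1

/-- The entry is non-zero at the real place. -/
theorem rho_ne_zero_of_famCheck₂ (hθ : aeval θ (MonicCubic.poly fc.a fc.b fc.c) = 0) (ρ : K →+* ℝ)
    (hlo : ((fc.lo : ℚ) : ℝ) < ρ θ) (hhi : ρ θ < ((fc.hi : ℚ) : ℝ)) (hF : fc.check = true)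
    (h : famCheck₂ fc D f = true) :
    ρ ((lin hθ f.2.2.g.1 f.2.2.g.2.1 f.2.2.g.2.2 : 𝓞 K) : K) ≠ 0 :=
  rho_lin_ne_zero_of_signCond hθ ρ (fc.interval_of_check hF).1 hlo hhi (common_of_famCheck₂ h).1

/-- Residue characters do not vanish on the entry. -/
theorem not_dvd_evalInt_of_famCheck₂ (h : famCheck₂ fc D f = true) {ch : ℕ × ℤ × ℤ} (hch : ch ∈ fc.chars) :
    ¬ (ch.1 : ℤ) ∣ evalInt ch.2.1 f.2.2.g :=
  (common_of_famCheck₂ h).2.2.1 ch hch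

omit [NumberField K] in
/-- A rational prime on the power basis. -/
theorem lin_natCast (hθ : aeval θ (MonicCubic.poly fc.a fc.b fc.c) = 0) (q : ℕ) :
    (lin hθ (q : ℤ) 0 0 : 𝓞 K) = ((q : ℕ) : 𝓞 K) := by
  simp [lin]

omit [NumberField K] in
/-- `q₁·q₂` on the power basis splits as a product. -/
theorem natCast_q₁q₂ : ((fc.q₁ * fc.q₂ : ℕ) : 𝓞 K) = ((fc.q₁ : ℕ) : 𝓞 K) * ((fc.q₂ : ℕ) : 𝓞 K) := by
  push_cast; rfl

/-- **Support**: every prime containing the entry contains `M = D·q₁q₂`. [cite: Marcus2018, Ch. 3, Thm. 22] -/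
theorem supp_of_famCheck₂ (hθ : aeval θ (MonicCubic.poly fc.a fc.b fc.c) = 0) (h3 : finrank ℚ K = 3)
    (hF : fc.check = true) (hpr : fc.primeList.Forall Nat.Prime) (h : famCheck₂ fc D f = true)
    (v : HeightOneSpectrum (𝓞 K)) (hv : (lin hθ f.2.2.g.1 f.2.2.g.2.1 f.2.2.g.2.2 : 𝓞 K) ∈ v.asIdeal) :
    (lin hθ D.1 D.2.1 D.2.2 : 𝓞 K) * ((fc.q₁ * fc.q₂ : ℕ) : 𝓞 K) ∈ v.asIdeal := by
  have hirr := fc.irreducible_of_check hF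
  have hk := (common_of_famCheck₂ h).2.2.2
  unfold famKindCheck₂ at hk
  split_ifs at hk with h0 h1 h4 h2 h3'
  · exact absurd hv (not_mem_of_unitCert hθ hk v)
  · rw [decide_eq_true_eq] at hk
    rw [hk] at hv
    simp only at hv
    rw [lin_natCast hθ] at hv
    rw [natCast_q₁q₂]
    exact Ideal.mul_mem_left _ _ (Ideal.mul_mem_right _ _ hv)
  · rw [decide_eq_true_eq] at hk
    rw [hk] at hv
    simp only at hv
    rw [lin_natCast hθ] at hv
    rw [natCast_q₁q₂]
    exact Ideal.mul_mem_left _ _ (Ideal.mul_mem_left _ _ hv)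
  · simp only [Bool.and_eq_true, decide_eq_true_eq, List.all_eq_true, Bool.or_eq_true, beq_iff_eq] at hk
    obtain ⟨⟨⟨⟨⟨⟨⟨⟨hany, hC⟩, hmem⟩, hpp⟩, -⟩, -⟩, -⟩, -⟩, hinvs⟩ := hk
    obtain ⟨hrow, hrowp⟩ := row_mem (fc := fc) (by simpa [List.any_eq_true] using hany)
    rcases natCast_mem_or_of_prodPowCert hθ hpp v hv with hp | hq
    · have hp' : ((fc.row f.2.1.1).p : 𝓞 K) ∈ v.asIdeal := by rw [hrowp]; exact hp
      obtain ⟨C', hC', hv'⟩ := exists_code_of_natCast_mem hirr hθ h3 (fc.prime_of_mem hpr hrow)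
        (fc.row_check_of_mem hF hrow).1 v hp'
      rcases hinvs C' hC' with rfl | hy
      · exact Ideal.mul_mem_right _ _ (lin_mem_of_memCode hθ v hv' D hmem)
      · exact absurd hv (lin_not_mem_of_invAny hθ v hv' hy)
    · exact Ideal.mul_mem_left _ _ hq
  · simp only [Bool.and_eq_true] at hk
    rcases natCast_mem_or_of_prodPowCert hθ hk.1.1.1.1 v hv with h1' | hq
    · exact absurd (v.isPrime.ne_top ((Ideal.eq_top_iff_one _).mpr (by simpa using h1'))) id
    · exact Ideal.mul_mem_left _ _ hq

/-- `|N(g)| = q^e · m`, `q ∤ m`, from `ordCheck` (any rational prime `q`). [folklore] -/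
theorem natAbs_norm_of_ordCheck₂ (hθ : aeval θ (MonicCubic.poly fc.a fc.b fc.c) = 0) (h3 : finrank ℚ K = 3)
    (hF : fc.check = true) {q : ℕ} {g : ℤ × ℤ × ℤ} {e : ℕ}
    (h : ordCheck q (normFormZ fc.a fc.b fc.c g.1 g.2.1 g.2.2).natAbs e = true) :
    (Algebra.norm ℤ (lin hθ g.1 g.2.1 g.2.2 : 𝓞 K)).natAbs =
        q ^ e * ((normFormZ fc.a fc.b fc.c g.1 g.2.1 g.2.2).natAbs / q ^ e) ∧
      ¬ q ∣ (normFormZ fc.a fc.b fc.c g.1 g.2.1 g.2.2).natAbs / q ^ e := by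
  simp only [ordCheck, decide_eq_true_eq] at h
  rw [natAbs_norm_lin_coords (fc.irreducible_of_check hF) hθ h3]
  exact h

/-- `|N(q)| = q³ · 1` for a rational prime `q` on the power basis. -/
theorem natAbs_norm_natCast (hθ : aeval θ (MonicCubic.poly fc.a fc.b fc.c) = 0) (h3 : finrank ℚ K = 3)
    (hF : fc.check = true) (q : ℕ) : (Algebra.norm ℤ ((q : ℕ) : 𝓞 K)).natAbs = q ^ 3 * 1 := by
  have e := natAbs_norm_lin_coords (fc.irreducible_of_check hF) hθ h3 ((q : ℤ), 0, 0)
  simp only at e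
  rw [lin_natCast hθ] at e
  rw [e]
  simp [normFormZ, Int.natAbs_pow]

section Logs
variable (hθ : aeval θ (MonicCubic.poly fc.a fc.b fc.c) = 0) (h3 : finrank ℚ K = 3) (hF : fc.check = true)
  (hpr : fc.primeList.Forall Nat.Prime)
include hθ h3 hF hpr

/-- The generic `ord_{W₁₁}(g) = e₁` computation from `g ∉ W₁₂` and `|N g| = q₁^{e₁}·m`, `q₁ ∤ m`. -/
theorem log_W₁₁_gen {g : ℤ × ℤ × ℤ} {ys : List (ℤ × ℤ × ℤ)} {e₁ : ℕ}
    (hinv : invAny fc.a fc.b fc.c fc.w₁₂ g ys = true)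
    (hord : ordCheck fc.q₁ (normFormZ fc.a fc.b fc.c g.1 g.2.1 g.2.2).natAbs e₁ = true) :
    WithZero.log ((fc.W₁₁ hθ h3 hF hpr).valuation K ((lin hθ g.1 g.2.1 g.2.2 : 𝓞 K) : K)) = -(e₁ : ℤ) := by
  have hq := fc.q₁_prime hpr
  obtain ⟨hN, hm⟩ := natAbs_norm_of_ordCheck₂ hθ h3 hF hord
  refine log_valuation_eq_of_forall_not_mem hq ({fc.W₁₁ hθ h3 hF hpr, fc.W₁₂ hθ h3 hF hpr} : Finset _)
    (fun u hu => by
      rcases eq_W₁₁_or_W₁₂ hθ h3 hF hpr u hu with h | h <;> simp [h])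
    (fun u => if u = fc.W₁₁ hθ h3 hF hpr then 1 else 2) (fun u hu => ?_) (by simp) (by simp) ?_ ?_ hm
  · simp only [Finset.mem_insert, Finset.mem_singleton] at hu
    rcases hu with rfl | rfl
    · simp [absNorm_W₁₁]
    · rw [if_neg (W₁₁_ne_W₁₂ hθ h3 hF hpr).symm]; exact absNorm_W₁₂ hθ h3 hF hpr
  · intro u hu hne
    simp only [Finset.mem_insert, Finset.mem_singleton] at hu
    rcases hu with rfl | rfl
    · exact absurd rfl hne
    · exact lin_not_mem_of_invAny hθ _ (W₁₂_asIdeal hθ h3 hF hpr) hinv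
  · simpa using hN

/-- The generic `ord_{W₂₁}(g) = e₂` computation from `g ∉ W₂₂` and `|N g| = q₂^{e₂}·m`, `q₂ ∤ m`. -/
theorem log_W₂₁_gen {g : ℤ × ℤ × ℤ} {ys : List (ℤ × ℤ × ℤ)} {e₂ : ℕ}
    (hinv : invAny fc.a fc.b fc.c fc.w₂₂ g ys = true)
    (hord : ordCheck fc.q₂ (normFormZ fc.a fc.b fc.c g.1 g.2.1 g.2.2).natAbs e₂ = true) :
    WithZero.log ((fc.W₂₁ hθ h3 hF hpr).valuation K ((lin hθ g.1 g.2.1 g.2.2 : 𝓞 K) : K)) = -(e₂ : ℤ) := by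
  have hq := fc.q₂_prime hpr
  obtain ⟨hN, hm⟩ := natAbs_norm_of_ordCheck₂ hθ h3 hF hord
  refine log_valuation_eq_of_forall_not_mem hq ({fc.W₂₁ hθ h3 hF hpr, fc.W₂₂ hθ h3 hF hpr} : Finset _)
    (fun u hu => by
      rcases eq_W₂₁_or_W₂₂ hθ h3 hF hpr u hu with h | h <;> simp [h])
    (fun u => if u = fc.W₂₁ hθ h3 hF hpr then 1 else 2) (fun u hu => ?_) (by simp) (by simp) ?_ ?_ hm
  · simp only [Finset.mem_insert, Finset.mem_singleton] at hu
    rcases hu with rfl | rfl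
    · simp [absNorm_W₂₁]
    · rw [if_neg (W₂₁_ne_W₂₂ hθ h3 hF hpr).symm]; exact absNorm_W₂₂ hθ h3 hF hpr
  · intro u hu hne
    simp only [Finset.mem_insert, Finset.mem_singleton] at hu
    rcases hu with rfl | rfl
    · exact absurd rfl hne
    · exact lin_not_mem_of_invAny hθ _ (W₂₂_asIdeal hθ h3 hF hpr) hinv
  · simpa using hN

/-- `ord_{W₁₁}(q₁) = ord_{W₁₂}(q₁) = 1`. -/
theorem log_q₁ :
    WithZero.log ((fc.W₁₁ hθ h3 hF hpr).valuation K ((((fc.q₁ : ℕ) : 𝓞 K) : 𝓞 K) : K)) = -1 ∧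
      WithZero.log ((fc.W₁₂ hθ h3 hF hpr).valuation K ((((fc.q₁ : ℕ) : 𝓞 K) : 𝓞 K) : K)) = -1 :=
  log_valuation_eq_neg_one_of_one_two (fc.q₁_prime hpr) (W₁₁_ne_W₁₂ hθ h3 hF hpr)
    (eq_W₁₁_or_W₁₂ hθ h3 hF hpr) (absNorm_W₁₁ hθ h3 hF hpr) (absNorm_W₁₂ hθ h3 hF hpr)
    (q₁_mem_W₁₁ hθ h3 hF hpr) (q₁_mem_W₁₂ hθ h3 hF hpr) (natAbs_norm_natCast hθ h3 hF fc.q₁)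
    (fun hd => (fc.q₁_prime hpr).one_lt.ne' (Nat.dvd_one.mp hd))

/-- `ord_{W₂₁}(q₂) = ord_{W₂₂}(q₂) = 1`. -/
theorem log_q₂ :
    WithZero.log ((fc.W₂₁ hθ h3 hF hpr).valuation K ((((fc.q₂ : ℕ) : 𝓞 K) : 𝓞 K) : K)) = -1 ∧
      WithZero.log ((fc.W₂₂ hθ h3 hF hpr).valuation K ((((fc.q₂ : ℕ) : 𝓞 K) : 𝓞 K) : K)) = -1 :=
  log_valuation_eq_neg_one_of_one_two (fc.q₂_prime hpr) (W₂₁_ne_W₂₂ hθ h3 hF hpr)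
    (eq_W₂₁_or_W₂₂ hθ h3 hF hpr) (absNorm_W₂₁ hθ h3 hF hpr) (absNorm_W₂₂ hθ h3 hF hpr)
    (q₂_mem_W₂₁ hθ h3 hF hpr) (q₂_mem_W₂₂ hθ h3 hF hpr) (natAbs_norm_natCast hθ h3 hF fc.q₂)
    (fun hd => (fc.q₂_prime hpr).one_lt.ne' (Nat.dvd_one.mp hd))

/-- **`log ord_{W₁₁}` of the entry.** [cite: Marcus2018, Ch. 3, Thm. 22] -/
theorem log_W₁₁_of_famCheck₂ (h : famCheck₂ fc D f = true) :
    WithZero.log ((fc.W₁₁ hθ h3 hF hpr).valuation K ((lin hθ f.2.2.g.1 f.2.2.g.2.1 f.2.2.g.2.2 : 𝓞 K) : K)) =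
      famL₁₁ f := by
  have hk := (common_of_famCheck₂ h).2.2.2
  unfold famKindCheck₂ at hk
  unfold famL₁₁
  split_ifs at hk ⊢ with h0 h1 h4 h2 h3'
  · exact log_valuation_eq_zero_of_unitCert hθ hk _
  · rw [decide_eq_true_eq] at hk
    rw [hk]; simp only; rw [lin_natCast hθ]
    exact (log_q₁ hθ h3 hF hpr).1
  · rw [decide_eq_true_eq] at hk
    rw [hk]; simp only; rw [lin_natCast hθ]
    rw [valuation_eq_one_of_not_mem _ (q₂_not_mem_of_q₁_mem hF hpr _ (q₁_mem_W₁₁ hθ h3 hF hpr)),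
      WithZero.log_one]
  · simp only [Bool.and_eq_true] at hk
    exact log_W₁₁_gen hθ h3 hF hpr hk.1.1.1.1.2 hk.1.1.2
  · simp only [Bool.and_eq_true] at hk
    exact log_W₁₁_gen hθ h3 hF hpr hk.1.1.1.2 hk.1.2

/-- **`log ord_{W₂₁}` of the entry.** [cite: Marcus2018, Ch. 3, Thm. 22] -/
theorem log_W₂₁_of_famCheck₂ (h : famCheck₂ fc D f = true) :
    WithZero.log ((fc.W₂₁ hθ h3 hF hpr).valuation K ((lin hθ f.2.2.g.1 f.2.2.g.2.1 f.2.2.g.2.2 : 𝓞 K) : K)) =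
      famL₂₁ f := by
  have hk := (common_of_famCheck₂ h).2.2.2
  unfold famKindCheck₂ at hk
  unfold famL₂₁
  split_ifs at hk ⊢ with h0 h1 h4 h2 h3'
  · exact log_valuation_eq_zero_of_unitCert hθ hk _
  · rw [decide_eq_true_eq] at hk
    rw [hk]; simp only; rw [lin_natCast hθ]
    rw [valuation_eq_one_of_not_mem _ (q₁_not_mem_of_q₂_mem hF hpr _ (q₂_mem_W₂₁ hθ h3 hF hpr)),
      WithZero.log_one]
  · rw [decide_eq_true_eq] at hk
    rw [hk]; simp only; rw [lin_natCast hθ]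
    exact (log_q₂ hθ h3 hF hpr).1
  · simp only [Bool.and_eq_true] at hk
    exact log_W₂₁_gen hθ h3 hF hpr hk.1.1.1.2 hk.1.2
  · simp only [Bool.and_eq_true] at hk
    exact log_W₂₁_gen hθ h3 hF hpr hk.1.1.2 hk.2

/-- **`log ord_{W₁₂}` of the entry.** [cite: Marcus2018, Ch. 3, Thm. 22] -/
theorem log_W₁₂_of_famCheck₂ (h : famCheck₂ fc D f = true) :
    WithZero.log ((fc.W₁₂ hθ h3 hF hpr).valuation K ((lin hθ f.2.2.g.1 f.2.2.g.2.1 f.2.2.g.2.2 : 𝓞 K) : K)) =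
      famL₁₂ f := by
  have hk := (common_of_famCheck₂ h).2.2.2
  unfold famKindCheck₂ at hk
  unfold famL₁₂
  by_cases h1 : f.1 = 1
  · have h0 : ¬ f.1 = 0 := by omega
    rw [if_neg h0, if_pos h1, decide_eq_true_eq] at hk
    rw [if_pos h1, hk]; simp only; rw [lin_natCast hθ]
    exact (log_q₁ hθ h3 hF hpr).2
  rw [if_neg h1]
  have hval : (fc.W₁₂ hθ h3 hF hpr).valuation K ((lin hθ f.2.2.g.1 f.2.2.g.2.1 f.2.2.g.2.2 : 𝓞 K) : K) = 1 := by
    split_ifs at hk with h0 h4 h2 h3'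
    · exact valuation_eq_one_of_unitCert hθ hk _
    · rw [decide_eq_true_eq] at hk
      rw [hk]; simp only; rw [lin_natCast hθ]
      exact valuation_eq_one_of_not_mem _ (q₂_not_mem_of_q₁_mem hF hpr _ (q₁_mem_W₁₂ hθ h3 hF hpr))
    · simp only [Bool.and_eq_true] at hk
      exact valuation_eq_one_of_invAny hθ _ (W₁₂_asIdeal hθ h3 hF hpr) hk.1.1.1.1.2
    · simp only [Bool.and_eq_true] at hk
      exact valuation_eq_one_of_invAny hθ _ (W₁₂_asIdeal hθ h3 hF hpr) hk.1.1.1.2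
  rw [hval, WithZero.log_one]

/-- **`log ord_{W₂₂}` of the entry.** [cite: Marcus2018, Ch. 3, Thm. 22] -/
theorem log_W₂₂_of_famCheck₂ (h : famCheck₂ fc D f = true) :
    WithZero.log ((fc.W₂₂ hθ h3 hF hpr).valuation K ((lin hθ f.2.2.g.1 f.2.2.g.2.1 f.2.2.g.2.2 : 𝓞 K) : K)) =
      famL₂₂ f := by
  have hk := (common_of_famCheck₂ h).2.2.2
  unfold famKindCheck₂ at hk
  unfold famL₂₂
  by_cases h4 : f.1 = 4
  · have h0 : ¬ f.1 = 0 := by omega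
    have h1 : ¬ f.1 = 1 := by omega
    rw [if_neg h0, if_neg h1, if_pos h4, decide_eq_true_eq] at hk
    rw [if_pos h4, hk]; simp only; rw [lin_natCast hθ]
    exact (log_q₂ hθ h3 hF hpr).2
  rw [if_neg h4]
  have hval : (fc.W₂₂ hθ h3 hF hpr).valuation K ((lin hθ f.2.2.g.1 f.2.2.g.2.1 f.2.2.g.2.2 : 𝓞 K) : K) = 1 := by
    split_ifs at hk with h0 h1 h2 h3'
    · exact valuation_eq_one_of_unitCert hθ hk _
    · rw [decide_eq_true_eq] at hk
      rw [hk]; simp only; rw [lin_natCast hθ]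
      exact valuation_eq_one_of_not_mem _ (q₁_not_mem_of_q₂_mem hF hpr _ (q₂_mem_W₂₂ hθ h3 hF hpr))
    · simp only [Bool.and_eq_true] at hk
      exact valuation_eq_one_of_invAny hθ _ (W₂₂_asIdeal hθ h3 hF hpr) hk.1.1.1.2
    · simp only [Bool.and_eq_true] at hk
      exact valuation_eq_one_of_invAny hθ _ (W₂₂_asIdeal hθ h3 hF hpr) hk.1.1.2
  rw [hval, WithZero.log_one]

end Logs

end Summit.BirchSwinnertonDyer.BirchSwinnertonDyer.Rank2Observatory.TwoDescCl
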